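import Mathlib.RepresentationTheory.Basic
import Mathlib.LinearAlgebra.Quotient.Basic
import Mathlib.LinearAlgebra.Span.Basic
import HarnessLib

/-!
# Twisted coinvariants of a pair of commuting representations

Kernel construction (generic, Mathlib only).  For COMMUTING representations `ρV : Representation k G S`,
`ρW : Representation k H S` of two groups on one module and a character `χ : H →* kˣ`:

* the relation submodule `ker ρW χ = span {ρW h v - χ h • v}`, the quotient `Coinv ρW χ := S ⧸ ker ρW χ`
  (the MAXIMAL quotient of `S` on which `H` acts through `χ`), the induced representation
  **`rep χ ρV hc : Representation k G (Coinv ρW χ)`** (`rep_mk : rep g (mk v) = mk (ρV g v)`; `H` acts through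
  `χ`: `mk_ρW`);
* the universal property **`lift f hf : Coinv ρW χ →ₗ[k] M`** for a linear `f : S →ₗ[k] M` with
  `f (ρW h v) = χ h • f v` (`lift_mk`, `range_lift`, `G`-equivariance `lift_rep`, `lift_unique`, `lift_eq_zero_iff`);
* the CENTRE LEMMAS in generic form: if `z ∈ G` and `w ∈ H` act on `S` by operators differing by a scalar `c`
  (`ρV z v = c • ρW w v` — the situation of the common centre of a reductive dual pair), then `z` acts on
  `Coinv ρW χ` by the scalar `c · χ w` (`rep_eq_smul_of_forall`), and (`k` a field, `c ≠ 0`) a NON-ZERO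
  `G`-intertwiner `Coinv ρW χ → Coinv ρW χ'` forces `χ w = χ' w` (`char_apply_eq_of_intertwiner`);
* §1b functoriality: change of module along `T : S →ₗ[k] S'` with `ρW' h (T v) = e h • T (ρW h v)` and
  `χ' = e · χ` pointwise — **`map`** (`map_mk`, `map_surjective`, `map_rep`), **`mapEquiv`** for a linear
  equivalence `T`, and equal relation submodules under a pointwise scalar twist on one module (`ker_eq_of_forall_smul`).

This is the module operation of [Liu 2021, App. D §D.1, Step 3] («the maximal quotient of `ω(ε, μ)` … with central
character `χ`») and of [MoeglinVignerasWaldspurger1987, Chap. 3 IV] (maximal isotypic quotients in Howe duality),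
written for an ARBITRARY second group `H` acting through a representation commuting with `ρV` — the shape of a dual
pair `U(V) × U(W)`, where `U(W)` is not a subgroup of `U(V)`.  Relation to existing tree / Mathlib operations
(design note, nothing is duplicated): Mathlib's `Representation.Coinvariants ρ` is the untwisted case `χ = 1` of ONE
representation; the tree's `Literature.RepresentationTheory.CentralCharacterQuotient.quotRep` is the case where `H = Z`
maps into the CENTRE of `G` (`ζ : Z →* G`) and acts through `ρ ∘ ζ` — for a dual pair the second member is a separate,
possibly non-abelian group, whence the two-representation form here.  The consumer is
`Literature/NumberTheory/GelbartRogawski1991/UnitaryDualPairWeilCoinvariants.lean` (the `χ`-coinvariants of the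
finite Weil representation of a unitary dual pair under its `U(W)`-member).

## References
* [Liu2021] Y. Liu, *Fourier–Jacobi cycles and arithmetic relative trace formula*, Camb. J. Math. 9 (2021) =
  arXiv:2102.11518: App. D §D.1, Step 3 of the construction before Lemma D.1 (FJcycle.tex l. 5218–5219).
* [MoeglinVignerasWaldspurger1987] C. Mœglin, M.-F. Vignéras, J.-L. Waldspurger, *Correspondances de Howe sur un
  corps p-adique*, LNM 1291 (1987), Chap. 2 II.2, Chap. 3 IV.
-/

noncomputable section

/-! ## §1. Twisted coinvariants of a pair of commuting representations -/

namespace Literature.RepresentationTheory.TwistedCoinv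

section CommRing

variable {k : Type*} [CommRing k] {G H S : Type*} [Group G] [Group H] [AddCommGroup S] [Module k S]

/-- The relation submodule `span {ρW h v - χ h • v}` of the `χ`-coinvariants. [folklore] -/
def ker (ρW : Representation k H S) (χ : H →* kˣ) : Submodule k S :=
  Submodule.span k (Set.range fun hv : H × S => ρW hv.1 hv.2 - ((χ hv.1 : kˣ) : k) • hv.2)

/-- **The `χ`-coinvariants** `S ⧸ span {ρW h v - χ h • v}`: the maximal quotient of `S` on which `H` acts through
the character `χ`. [cite: Liu2021, App. D §D.1 Step 3 (l. 5219)] -/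
abbrev Coinv (ρW : Representation k H S) (χ : H →* kˣ) : Type _ := S ⧸ ker ρW χ

variable (ρW : Representation k H S) (χ : H →* kˣ)

/-- the generators lie in the relation submodule. [cite: Liu2021, App. D §D.1 Step 3 (l. 5219)] -/
theorem sub_mem_ker (h : H) (v : S) : ρW h v - ((χ h : kˣ) : k) • v ∈ ker ρW χ :=
  Submodule.subset_span ⟨(h, v), rfl⟩

/-- The quotient map `S → Coinv ρW χ`. [folklore] -/
def mk : S →ₗ[k] Coinv ρW χ := (ker ρW χ).mkQ

/-- `mk` is the quotient map `Submodule.Quotient.mk`, pointwise. [cite: Liu2021, App. D §D.1 Step 3 (l. 5219)] -/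
theorem mk_apply (v : S) : mk ρW χ v = Submodule.Quotient.mk v := rfl

/-- `mk` is surjective. [cite: Liu2021, App. D §D.1 Step 3 (l. 5219)] -/
theorem mk_surjective : Function.Surjective (mk ρW χ) := Submodule.mkQ_surjective _

/-- **`H` acts through `χ` on the coinvariants**: `mk (ρW h v) = χ h • mk v`. [cite: Liu2021, App. D §D.1 Step 3 (l. 5219)] -/
theorem mk_ρW (h : H) (v : S) : mk ρW χ (ρW h v) = ((χ h : kˣ) : k) • mk ρW χ v := by
  rw [← sub_eq_zero, ← map_smul, ← map_sub, mk, Submodule.mkQ_apply, Submodule.Quotient.mk_eq_zero]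
  exact sub_mem_ker ρW χ h v

variable {M : Type*} [AddCommGroup M] [Module k M]

/-- Two linear maps out of the coinvariants agreeing on all `mk v` are equal. [cite: Liu2021, App. D §D.1 Step 3 (l. 5219)] -/
theorem ext_mk {f g : Coinv ρW χ →ₗ[k] M} (hfg : ∀ v : S, f (mk ρW χ v) = g (mk ρW χ v)) : f = g :=
  Submodule.linearMap_qext _ (LinearMap.ext hfg)

variable {ρW}
variable (ρV : Representation k G S)

/-- The relation submodule is stable under every operator `ρV g` commuting with `ρW(H)`. [cite: Liu2021, App. D §D.1 Step 3 (l. 5219)] -/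
theorem map_ker_le (hc : ∀ (g : G) (h : H), Commute (ρV g) (ρW h)) (g : G) : (ker ρW χ).map (ρV g) ≤ ker ρW χ := by
  rw [ker, Submodule.map_span_le]
  rintro _ ⟨⟨h, v⟩, rfl⟩
  have hcomm : ρV g (ρW h v) = ρW h (ρV g v) := by
    simpa only [Module.End.mul_apply] using LinearMap.congr_fun (hc g h).eq v
  dsimp only
  rw [map_sub, map_smul, hcomm]
  exact sub_mem_ker ρW χ h (ρV g v)

/-- the operator induced by `ρV g` on the coinvariants. [folklore] -/
def act (hc : ∀ (g : G) (h : H), Commute (ρV g) (ρW h)) (g : G) : Coinv ρW χ →ₗ[k] Coinv ρW χ :=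
  (ker ρW χ).mapQ (ker ρW χ) (ρV g) (Submodule.map_le_iff_le_comap.1 (map_ker_le χ ρV hc g))

/-- `act g (mk v) = mk (ρV g v)`. [cite: Liu2021, App. D §D.1 Step 3 (l. 5219)] -/
@[simp] theorem act_mk (hc : ∀ (g : G) (h : H), Commute (ρV g) (ρW h)) (g : G) (v : S) : act χ ρV hc g (mk ρW χ v) = mk ρW χ (ρV g v) := rfl

/-- **The representation of `G` on the `χ`-coinvariants of `H`** (for `ρV`, `ρW` commuting). [cite: Liu2021, App. D
proof of Lemma D.1 Step 3] -/
def rep (hc : ∀ (g : G) (h : H), Commute (ρV g) (ρW h)) : Representation k G (Coinv ρW χ) where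
  toFun := act χ ρV hc
  map_one' := ext_mk ρW χ fun v => by
    rw [act_mk, map_one, Module.End.one_apply, Module.End.one_apply]
  map_mul' g g' := ext_mk ρW χ fun v => by
    rw [act_mk, map_mul, Module.End.mul_apply, Module.End.mul_apply, act_mk, act_mk]

/-- `rep g (mk v) = mk (ρV g v)`. [cite: Liu2021, App. D §D.1 Step 3 (l. 5219)] -/
@[simp] theorem rep_mk (hc : ∀ (g : G) (h : H), Commute (ρV g) (ρW h)) (g : G) (v : S) : rep χ ρV hc g (mk ρW χ v) = mk ρW χ (ρV g v) := rfl

/-- `mk (ρV g (ρW h v)) = χ h • rep g (mk v)`: the pair `(g, h)` acts by `χ h · rep g`. [cite: Liu2021, App. D §D.1 Step 3 (l. 5219)] -/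
theorem mk_ρV_ρW (hc : ∀ (g : G) (h : H), Commute (ρV g) (ρW h)) (g : G) (h : H) (v : S) :
    mk ρW χ (ρV g (ρW h v)) = ((χ h : kˣ) : k) • rep χ ρV hc g (mk ρW χ v) := by
  rw [rep_mk, ← mk_ρW]
  congr 1
  simpa only [Module.End.mul_apply] using LinearMap.congr_fun (hc g h).eq v

/-! ### The universal property -/

section Lift

variable (ρW)

/-- A map transforming under `H` by `χ` kills the relation submodule. [cite: Liu2021, App. D §D.1 Step 3 (l. 5219)] -/
theorem ker_le_ker (f : S →ₗ[k] M) (hf : ∀ (h : H) (v : S), f (ρW h v) = ((χ h : kˣ) : k) • f v) :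
    ker ρW χ ≤ LinearMap.ker f := by
  rw [ker, Submodule.span_le]
  rintro _ ⟨⟨h, v⟩, rfl⟩
  rw [SetLike.mem_coe, LinearMap.mem_ker, map_sub, map_smul, hf, sub_self]

/-- **The universal property of the `χ`-coinvariants**: a linear map `f : S → M` with `f (ρW h v) = χ h • f v`
factors through `Coinv ρW χ`. [folklore] -/
def lift (f : S →ₗ[k] M) (hf : ∀ (h : H) (v : S), f (ρW h v) = ((χ h : kˣ) : k) • f v) :
    Coinv ρW χ →ₗ[k] M :=
  (ker ρW χ).liftQ f (ker_le_ker ρW χ f hf)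

/-- `lift f hf (mk v) = f v`. [cite: Liu2021, App. D §D.1 Step 3 (l. 5219)] -/
@[simp] theorem lift_mk (f : S →ₗ[k] M) (hf : ∀ (h : H) (v : S), f (ρW h v) = ((χ h : kˣ) : k) • f v) (v : S) :
    lift ρW χ f hf (mk ρW χ v) = f v := rfl

/-- `lift f hf ∘ mk = f`. [cite: Liu2021, App. D §D.1 Step 3 (l. 5219)] -/
theorem lift_comp_mk (f : S →ₗ[k] M) (hf : ∀ (h : H) (v : S), f (ρW h v) = ((χ h : kˣ) : k) • f v) :
    lift ρW χ f hf ∘ₗ mk ρW χ = f := LinearMap.ext fun _ => rfl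

/-- **`range (lift f) = range f`** (the image of the factored map is the image of `f`). [cite: Liu2021, App. D §D.1 Step 3 (l. 5219)] -/
theorem range_lift (f : S →ₗ[k] M) (hf : ∀ (h : H) (v : S), f (ρW h v) = ((χ h : kˣ) : k) • f v) :
    LinearMap.range (lift ρW χ f hf) = LinearMap.range f :=
  Submodule.range_liftQ _ _ _

/-- uniqueness of the factorisation. [cite: Liu2021, App. D §D.1 Step 3 (l. 5219)] -/
theorem lift_unique (f : S →ₗ[k] M) (hf : ∀ (h : H) (v : S), f (ρW h v) = ((χ h : kˣ) : k) • f v) (F : Coinv ρW χ →ₗ[k] M) (hF : ∀ v : S, F (mk ρW χ v) = f v) : F = lift ρW χ f hf :=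
  ext_mk ρW χ fun v => by rw [hF, lift_mk]

/-- the factored map vanishes iff `f` does. [cite: Liu2021, App. D §D.1 Step 3 (l. 5219)] -/
theorem lift_eq_zero_iff (f : S →ₗ[k] M) (hf : ∀ (h : H) (v : S), f (ρW h v) = ((χ h : kˣ) : k) • f v) :
    lift ρW χ f hf = 0 ↔ f = 0 := by
  constructor
  · intro h0
    rw [← lift_comp_mk ρW χ f hf, h0, LinearMap.zero_comp]
  · intro h0
    exact ext_mk ρW χ fun v => by rw [lift_mk, h0, LinearMap.zero_apply, LinearMap.zero_apply]

variable {ρW}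

/-- **`G`-equivariance of the factored map**: if `f` intertwines `ρV` with a representation `σ` of `G` on `M`,
then so does `lift f` with `rep`. [cite: Liu2021, App. D §D.1 Step 3 (l. 5219)] -/
theorem lift_rep (hc : ∀ (g : G) (h : H), Commute (ρV g) (ρW h)) (f : S →ₗ[k] M) (hf : ∀ (h : H) (v : S), f (ρW h v) = ((χ h : kˣ) : k) • f v)
    (σ : Representation k G M) (hσ : ∀ (g : G) (v : S), f (ρV g v) = σ g (f v)) (g : G)
    (x : Coinv ρW χ) : lift ρW χ f hf (rep χ ρV hc g x) = σ g (lift ρW χ f hf x) := by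
  obtain ⟨v, rfl⟩ := mk_surjective ρW χ x
  rw [rep_mk, lift_mk, lift_mk, hσ]

/-- the same as an identity of linear maps. [cite: Liu2021, App. D §D.1 Step 3 (l. 5219)] -/
theorem lift_comp_rep (hc : ∀ (g : G) (h : H), Commute (ρV g) (ρW h)) (f : S →ₗ[k] M) (hf : ∀ (h : H) (v : S), f (ρW h v) = ((χ h : kˣ) : k) • f v)
    (σ : Representation k G M) (hσ : ∀ (g : G) (v : S), f (ρV g v) = σ g (f v)) (g : G) :
    lift ρW χ f hf ∘ₗ rep χ ρV hc g = σ g ∘ₗ lift ρW χ f hf :=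
  LinearMap.ext (lift_rep χ ρV hc f hf σ hσ g)

/-- the range of an equivariant `f` is `σ`-stable (so `range (lift f) = range f` is a subrepresentation).
[cite: Liu2021, App. D §D.1 Step 3 (l. 5219)] -/
theorem range_le_comap (f : S →ₗ[k] M) (σ : Representation k G M) (hσ : ∀ (g : G) (v : S), f (ρV g v) = σ g (f v)) (g : G) :
    LinearMap.range f ≤ (LinearMap.range f).comap (σ g) := by
  rintro _ ⟨v, rfl⟩
  exact ⟨ρV g v, hσ g v⟩

end Lift

/-! ### The centre lemmas (generic form) -/

/-- **An element of `G` whose operator is a scalar multiple of an operator of `H` acts on the coinvariants by a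
scalar**: `ρV z = c • ρW w` on `S` ⇒ `rep z = (c · χ w) • id` on `Coinv ρW χ`.  (The common centre `E¹` of a
unitary dual pair: `ι(z ⊗ 1) = ι(1 ⊗ z)` in `Sp(𝕎)`, so two splittings differ there by `ker π`.) [cite: Liu2021, App. D §D.1 Step 3 (l. 5219)] -/
theorem rep_eq_smul_of_forall (hc : ∀ (g : G) (h : H), Commute (ρV g) (ρW h)) {z : G} {w : H} {c : k} (hzw : ∀ v : S, ρV z v = c • ρW w v) (x : Coinv ρW χ) :
    rep χ ρV hc z x = (c * ((χ w : kˣ) : k)) • x := by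
  obtain ⟨v, rfl⟩ := mk_surjective ρW χ x
  rw [rep_mk, hzw, map_smul, mk_ρW, smul_smul]

/-! ### §1b. Functoriality: change of module and pointwise scalar twists -/

section Map

variable {S' : Type*} [AddCommGroup S'] [Module k S']

/-- **Equal relation submodules under a pointwise scalar twist** (one module): if `ρW' h = e h • ρW h` and
`χ' h = e h · χ h` for units `e h`, then `ker ρW' χ' = ker ρW χ` — the generators differ by the units `e h`.
(The situation of two compatible splittings of a dual pair differing by a central character.) [cite: GelbartRogawski1991, §3.1 Remark p. 457 L4–13] -/
theorem ker_eq_of_forall_smul {ρW ρW' : Representation k H S} {χ χ' : H →* kˣ} (e : H → kˣ)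
    (hρ : ∀ (h : H) (v : S), ρW' h v = ((e h : kˣ) : k) • ρW h v) (hχ : ∀ h : H, χ' h = e h * χ h) :
    ker ρW' χ' = ker ρW χ := by
  have key : ∀ (h : H) (v : S),
      ρW' h v - ((χ' h : kˣ) : k) • v = ((e h : kˣ) : k) • (ρW h v - ((χ h : kˣ) : k) • v) := fun h v => by
    rw [hρ, hχ, Units.val_mul, smul_sub, smul_smul]
  refine le_antisymm ?_ ?_
  · rw [ker, Submodule.span_le]
    rintro _ ⟨⟨h, v⟩, rfl⟩
    show ρW' h v - ((χ' h : kˣ) : k) • v ∈ ker ρW χ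
    rw [key]
    exact Submodule.smul_mem _ _ (sub_mem_ker ρW χ h v)
  · rw [ker, Submodule.span_le]
    rintro _ ⟨⟨h, v⟩, rfl⟩
    have hinv : ρW h v - ((χ h : kˣ) : k) • v = (((e h)⁻¹ : kˣ) : k) • (ρW' h v - ((χ' h : kˣ) : k) • v) := by
      rw [key, smul_smul, Units.inv_mul, one_smul]
    show ρW h v - ((χ h : kˣ) : k) • v ∈ ker ρW' χ'
    rw [hinv]
    exact Submodule.smul_mem _ _ (sub_mem_ker ρW' χ' h v)

variable (ρW)
variable (ρW' : Representation k H S') (χ' : H →* kˣ)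

/-- **Functoriality of the `χ`-coinvariants**: a linear map `T : S → S'` such that `ρW' h (T v) = e h • T (ρW h v)`
for units `e h` (i.e. `T` intertwines `ρW` with the twist of `ρW'` by `e⁻¹`) descends to
`Coinv ρW χ → Coinv ρW' χ'` as soon as `χ' h = e h · χ h`. [folklore] -/
def map (T : S →ₗ[k] S') (e : H → kˣ) (hT : ∀ (h : H) (v : S), ρW' h (T v) = ((e h : kˣ) : k) • T (ρW h v))
    (hχ : ∀ h : H, χ' h = e h * χ h) : Coinv ρW χ →ₗ[k] Coinv ρW' χ' :=
  lift ρW χ (mk ρW' χ' ∘ₗ T) fun h v => by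
    have h1 : T (ρW h v) = (((e h)⁻¹ : kˣ) : k) • ρW' h (T v) := by
      rw [hT, smul_smul, Units.inv_mul, one_smul]
    rw [LinearMap.comp_apply, LinearMap.comp_apply, h1, map_smul, mk_ρW, smul_smul, hχ, Units.val_mul, ← mul_assoc,
      Units.inv_mul, one_mul]

/-- `map T e hT hχ (mk v) = mk (T v)`. [cite: GelbartRogawski1991, §3.1 Remark p. 457 L4–13] -/
@[simp] theorem map_mk (T : S →ₗ[k] S') (e : H → kˣ)
    (hT : ∀ (h : H) (v : S), ρW' h (T v) = ((e h : kˣ) : k) • T (ρW h v)) (hχ : ∀ h : H, χ' h = e h * χ h) (v : S) :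
    map ρW χ ρW' χ' T e hT hχ (mk ρW χ v) = mk ρW' χ' (T v) := rfl

/-- `map` is onto when `T` is. [cite: GelbartRogawski1991, §3.1 Remark p. 457 L4–13] -/
theorem map_surjective (T : S →ₗ[k] S') (e : H → kˣ)
    (hT : ∀ (h : H) (v : S), ρW' h (T v) = ((e h : kˣ) : k) • T (ρW h v)) (hχ : ∀ h : H, χ' h = e h * χ h)
    (hsurj : Function.Surjective T) : Function.Surjective (map ρW χ ρW' χ' T e hT hχ) := by
  intro y
  obtain ⟨w, rfl⟩ := mk_surjective ρW' χ' y
  obtain ⟨v, rfl⟩ := hsurj w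
  exact ⟨mk ρW χ v, rfl⟩

/-- **Equivariance up to a scalar**: if `ρV' g' (T v) = a • T (ρV g v)` on `S` (two commuting pairs `(ρV, ρW)` on `S`,
`(ρV', ρW')` on `S'`, elements `g ∈ G`, `g' ∈ G'`), then `rep g' (map x) = a • map (rep g x)`. [cite: GelbartRogawski1991, §3.1 Remark p. 457 L4–13] -/
theorem map_rep {G' : Type*} [Group G'] (ρV : Representation k G S) (ρV' : Representation k G' S')
    (hc : ∀ (g : G) (h : H), Commute (ρV g) (ρW h)) (hc' : ∀ (g' : G') (h : H), Commute (ρV' g') (ρW' h))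
    (T : S →ₗ[k] S') (e : H → kˣ)
    (hT : ∀ (h : H) (v : S), ρW' h (T v) = ((e h : kˣ) : k) • T (ρW h v)) (hχ : ∀ h : H, χ' h = e h * χ h)
    {g : G} {g' : G'} {a : k} (hg : ∀ v : S, ρV' g' (T v) = a • T (ρV g v)) (x : Coinv ρW χ) :
    rep χ' ρV' hc' g' (map ρW χ ρW' χ' T e hT hχ x) = a • map ρW χ ρW' χ' T e hT hχ (rep χ ρV hc g x) := by
  obtain ⟨v, rfl⟩ := mk_surjective ρW χ x
  rw [map_mk, rep_mk, rep_mk, map_mk, hg, map_smul]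

/-- the inverse direction of the hypotheses of `map` along a linear equivalence. [cite: GelbartRogawski1991, §3.1 Remark p. 457 L4–13] -/
theorem map_hyp_symm (T : S ≃ₗ[k] S') (e : H → kˣ)
    (hT : ∀ (h : H) (v : S), ρW' h (T v) = ((e h : kˣ) : k) • T (ρW h v)) (h : H) (w : S') :
    ρW h (T.symm w) = (((e h)⁻¹ : kˣ) : k) • T.symm (ρW' h w) := by
  have h1 := hT h (T.symm w)
  rw [LinearEquiv.apply_symm_apply] at h1
  rw [h1, map_smul, LinearEquiv.symm_apply_apply, smul_smul, Units.inv_mul, one_smul]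

/-- **Functoriality along a linear equivalence**: `Coinv ρW χ ≃ Coinv ρW' χ'` for `T : S ≃ₗ[k] S'` with
`ρW' h (T v) = e h • T (ρW h v)`, `χ' = e · χ`. [folklore] -/
def mapEquiv (T : S ≃ₗ[k] S') (e : H → kˣ)
    (hT : ∀ (h : H) (v : S), ρW' h (T v) = ((e h : kˣ) : k) • T (ρW h v)) (hχ : ∀ h : H, χ' h = e h * χ h) :
    Coinv ρW χ ≃ₗ[k] Coinv ρW' χ' :=
  LinearEquiv.ofLinear (map ρW χ ρW' χ' T.toLinearMap e hT hχ)
    (map ρW' χ' ρW χ T.symm.toLinearMap (fun h => (e h)⁻¹) (map_hyp_symm ρW ρW' T e hT)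
      (fun h => by rw [hχ, ← mul_assoc, inv_mul_cancel, one_mul]))
    (ext_mk ρW' χ' fun w => by
      rw [LinearMap.comp_apply, LinearMap.id_apply, map_mk, LinearEquiv.coe_toLinearMap, map_mk,
        LinearEquiv.coe_toLinearMap, LinearEquiv.apply_symm_apply])
    (ext_mk ρW χ fun v => by
      rw [LinearMap.comp_apply, LinearMap.id_apply, map_mk, LinearEquiv.coe_toLinearMap, map_mk,
        LinearEquiv.coe_toLinearMap, LinearEquiv.symm_apply_apply])

/-- `mapEquiv` is `map` on elements. [cite: GelbartRogawski1991, §3.1 Remark p. 457 L4–13] -/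
theorem mapEquiv_apply (T : S ≃ₗ[k] S') (e : H → kˣ)
    (hT : ∀ (h : H) (v : S), ρW' h (T v) = ((e h : kˣ) : k) • T (ρW h v)) (hχ : ∀ h : H, χ' h = e h * χ h)
    (x : Coinv ρW χ) : mapEquiv ρW χ ρW' χ' T e hT hχ x = map ρW χ ρW' χ' T.toLinearMap e hT hχ x := rfl

/-- `mapEquiv T e hT hχ (mk v) = mk (T v)`. [cite: GelbartRogawski1991, §3.1 Remark p. 457 L4–13] -/
@[simp] theorem mapEquiv_mk (T : S ≃ₗ[k] S') (e : H → kˣ)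
    (hT : ∀ (h : H) (v : S), ρW' h (T v) = ((e h : kˣ) : k) • T (ρW h v)) (hχ : ∀ h : H, χ' h = e h * χ h) (v : S) :
    mapEquiv ρW χ ρW' χ' T e hT hχ (mk ρW χ v) = mk ρW' χ' (T v) := rfl

/-- the inverse of `mapEquiv` on classes: `symm (mk w) = mk (T.symm w)`. [cite: GelbartRogawski1991, §3.1 Remark p. 457 L4–13] -/
@[simp] theorem mapEquiv_symm_mk (T : S ≃ₗ[k] S') (e : H → kˣ)
    (hT : ∀ (h : H) (v : S), ρW' h (T v) = ((e h : kˣ) : k) • T (ρW h v)) (hχ : ∀ h : H, χ' h = e h * χ h) (w : S') :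
    (mapEquiv ρW χ ρW' χ' T e hT hχ).symm (mk ρW' χ' w) = mk ρW χ (T.symm w) := rfl

/-- equivariance of `mapEquiv` up to a scalar (as `map_rep`). [cite: GelbartRogawski1991, §3.1 Remark p. 457 L4–13] -/
theorem mapEquiv_rep {G' : Type*} [Group G'] (ρV : Representation k G S) (ρV' : Representation k G' S')
    (hc : ∀ (g : G) (h : H), Commute (ρV g) (ρW h)) (hc' : ∀ (g' : G') (h : H), Commute (ρV' g') (ρW' h))
    (T : S ≃ₗ[k] S') (e : H → kˣ)
    (hT : ∀ (h : H) (v : S), ρW' h (T v) = ((e h : kˣ) : k) • T (ρW h v)) (hχ : ∀ h : H, χ' h = e h * χ h)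
    {g : G} {g' : G'} {a : k} (hg : ∀ v : S, ρV' g' (T v) = a • T (ρV g v)) (x : Coinv ρW χ) :
    rep χ' ρV' hc' g' (mapEquiv ρW χ ρW' χ' T e hT hχ x) = a • mapEquiv ρW χ ρW' χ' T e hT hχ (rep χ ρV hc g x) :=
  map_rep ρW χ ρW' χ' ρV ρV' hc hc' T.toLinearMap e hT hχ hg x

end Map

end CommRing

section Field

variable {k : Type*} [Field k] {G H S : Type*} [Group G] [Group H] [AddCommGroup S] [Module k S]
variable {ρW : Representation k H S} (χ χ' : H →* kˣ) (ρV : Representation k G S)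

/-- **Distinct central characters ⇒ no non-zero intertwiner** (generic form, `k` a field): if `ρV z = c • ρW w`
on `S` with `c ≠ 0`, then a `G`-intertwiner `T : Coinv ρW χ → Coinv ρW χ'` (for the element `z`) with a non-zero
value forces `χ w = χ' w`. [cite: Liu2021, App. D Lemma D.1 (3) (l. 5233)] -/
theorem char_apply_eq_of_intertwiner (hc : ∀ (g : G) (h : H), Commute (ρV g) (ρW h)) {z : G} {w : H} {c : k} (hc0 : c ≠ 0)
    (hzw : ∀ v : S, ρV z v = c • ρW w v) (T : Coinv ρW χ →ₗ[k] Coinv ρW χ')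
    (hT : ∀ x : Coinv ρW χ, T (rep χ ρV hc z x) = rep χ' ρV hc z (T x)) {x : Coinv ρW χ} (hx : T x ≠ 0) :
    χ w = χ' w := by
  have h1 := hT x
  rw [rep_eq_smul_of_forall χ ρV hc hzw, rep_eq_smul_of_forall χ' ρV hc hzw, map_smul] at h1
  have h2 : (c * ((χ w : kˣ) : k) - c * ((χ' w : kˣ) : k)) • T x = 0 := by
    rw [sub_smul, h1, sub_self]
  rcases smul_eq_zero.1 h2 with h3 | h3
  · exact Units.ext (mul_left_cancel₀ hc0 (sub_eq_zero.1 h3))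
  · exact absurd h3 hx

/-- Contrapositive packaging: if `χ w ≠ χ' w` then every `G`-intertwiner (for `z`) `Coinv ρW χ → Coinv ρW χ'` is
zero. [cite: Liu2021, App. D Lemma D.1 (3) (l. 5233)] -/
theorem intertwiner_eq_zero_of_char_apply_ne (hc : ∀ (g : G) (h : H), Commute (ρV g) (ρW h)) {z : G} {w : H} {c : k} (hc0 : c ≠ 0)
    (hzw : ∀ v : S, ρV z v = c • ρW w v) (hne : χ w ≠ χ' w) (T : Coinv ρW χ →ₗ[k] Coinv ρW χ')
    (hT : ∀ x : Coinv ρW χ, T (rep χ ρV hc z x) = rep χ' ρV hc z (T x)) : T = 0 := by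
  refine LinearMap.ext fun x => ?_
  by_contra hx
  exact hne (char_apply_eq_of_intertwiner χ χ' ρV hc hc0 hzw T hT hx)

end Field

end Literature.RepresentationTheory.TwistedCoinv
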